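import Literature.MathematicalPhysics.QuantumLattice.SectorPropagatorSupBound
import Mathlib.MeasureTheory.Function.L2Space
import HarnessLib

/-!
# The single-scale sector propagators are Gram matrices in `L²(ℝ³)` (BGM 2003 (3.50a)–(3.52))

Topic `Literature/MathematicalPhysics/QuantumLattice`; the continuum companion of
`CutoffPropagatorGram.lean` (finite momentum sums) for the sector propagators of
`SectorPropagatorSupBound.lean`. Benfatto–Giuliani–Mastropietro 2003, after (3.50): "Let
`ℋ = ℝ^{|O_h|} ⊗ ℝ^s ⊗ L²(ℝ³)`; it can be shown that `G^{h,T} = ⟨… ⊗ A_{x,ω}, … ⊗ B_{y,ω}⟩` …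
with `‖A‖·‖B‖` satisfying the same dimensional bound as" the propagator; this is the input of
the Gram–Hadamard bound (2.80) of BGM 2006. PROVED here, in the symmetric normalisation
`A_x(k) = e^{-ikx} √N(k)/√|D(k)|`, `B_y(k) = e^{-iky} √N(k)√|D(k)|/D(k)` (`N = F_{h,ω} ζ χ ≥ 0` the
numerator, `D = -ik₀ + ε - μ`):

* `sectorGramA`, `sectorGramB` — the Gram vectors in `L²(ℝ × ℝ², ℂ)` (`Lp ℂ 2`);
* `inner_sectorGramA_sectorGramB` — **`⟪A_x, B_y⟫ = g^{(h)}_ω(x - y)`**;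
* `norm_sq_sectorGramA_le`, `norm_sq_sectorGramB_le` — `‖A_x‖², ‖B_y‖² = ∫ N/|D| ≤ 128 B₁(n) B₂(n)`,
  the same dimensional bound as `|g^{(h)}_ω|` (`norm_sectorPropagator_le`): each norm is
  `O(γ^{(3/4)h})`.

Everything is PROVED; the definitions are the two pointwise Gram functions and their `L²` classes.

## Sources

* G. Benfatto, A. Giuliani, V. Mastropietro, Ann. Henri Poincaré 4 (2003) 137–193, §3
  (3.50)–(3.52) (arXiv:cond-mat/0207210 p. 14). [BenfattoGiulianiMastropietro2003]
* G. Benfatto, A. Giuliani, V. Mastropietro, Ann. Henri Poincaré 7 (2006) 809–898, §2.6 (2.80).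
  [BenfattoGiulianiMastropietro2006]
-/

noncomputable section

open Real Set MeasureTheory Complex
open scoped InnerProductSpace ComplexConjugate ENNReal

namespace Literature.MathematicalPhysics.QuantumLattice

/-! ### The pointwise Gram functions -/

/-- The plane wave `e^{i(k⃗·x⃗ - k₀x₀)}` of the sector propagator. [folklore] -/
def sectorPlaneWave (x₀ : ℝ) (x : Fin 2 → ℝ) (p : ℝ × (Fin 2 → ℝ)) : ℂ :=
  Complex.exp (((p.2 0 * x 0 + p.2 1 * x 1 - p.1 * x₀ : ℝ) : ℂ) * Complex.I)

/-- The numerator `N = F_{h,ω}(k) χ(k⃗) ∈ [0, 1]` of the sector symbol. [cite: BenfattoGiulianiMastropietro2006, §2.5 (2.49)] -/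
def sectorNumer (e₀ μ : ℝ) (n : ℕ) (ω : ℤ) (p : ℝ × (Fin 2 → ℝ)) : ℝ :=
  anisotropicCutoff e₀ μ n ω p * zoneBump p.2

/-- The Gram function `A_x(k) = conj(e^{i(k⃗·x⃗ - k₀x₀)}) √N(k)/√|D(k)|`. [cite: BenfattoGiulianiMastropietro2003, §3 (3.52)] -/
def sectorGramAFun (e₀ μ : ℝ) (n : ℕ) (ω : ℤ) (x₀ : ℝ) (x : Fin 2 → ℝ) (p : ℝ × (Fin 2 → ℝ)) : ℂ :=
  conj (sectorPlaneWave x₀ x p) * ((Real.sqrt (sectorNumer e₀ μ n ω p) / Real.sqrt ‖sectorDenom μ p‖ : ℝ) : ℂ)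

/-- The Gram function `B_y(k) = conj(e^{i(k⃗·y⃗ - k₀y₀)}) √N(k)√|D(k)|/D(k)`. [cite: BenfattoGiulianiMastropietro2003, §3 (3.52)] -/
def sectorGramBFun (e₀ μ : ℝ) (n : ℕ) (ω : ℤ) (y₀ : ℝ) (y : Fin 2 → ℝ) (p : ℝ × (Fin 2 → ℝ)) : ℂ :=
  conj (sectorPlaneWave y₀ y p) *
    (((Real.sqrt (sectorNumer e₀ μ n ω p) * Real.sqrt ‖sectorDenom μ p‖ : ℝ) : ℂ) / sectorDenom μ p)

/-- `|e^{iφ}| = 1`. [folklore] -/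
theorem norm_sectorPlaneWave (x₀ : ℝ) (x : Fin 2 → ℝ) (p : ℝ × (Fin 2 → ℝ)) : ‖sectorPlaneWave x₀ x p‖ = 1 := by
  rw [sectorPlaneWave, Complex.norm_exp_ofReal_mul_I]

/-- The phases multiply to the phase of the difference: `e^{iφ(x)} conj(e^{iφ(y)}) = e^{iφ(x-y)}`. [folklore] -/
theorem sectorPlaneWave_mul_conj (x₀ y₀ : ℝ) (x y : Fin 2 → ℝ) (p : ℝ × (Fin 2 → ℝ)) :
    sectorPlaneWave x₀ x p * conj (sectorPlaneWave y₀ y p) = sectorPlaneWave (x₀ - y₀) (x - y) p := by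
  rw [sectorPlaneWave, sectorPlaneWave, sectorPlaneWave, ← Complex.exp_conj, ← Complex.exp_add]
  congr 1
  simp only [map_mul, Complex.conj_ofReal, Complex.conj_I, Pi.sub_apply]
  push_cast
  ring

/-- `0 ≤ N ≤ 1`. [folklore] -/
theorem sectorNumer_mem_Icc {e₀ μ : ℝ} (he : 0 < e₀) (n : ℕ) (ω : ℤ) (p : ℝ × (Fin 2 → ℝ)) :
    sectorNumer e₀ μ n ω p ∈ Icc (0 : ℝ) 1 :=
  ⟨mul_nonneg (anisotropicCutoff_mem_Icc he n ω p).1 (zoneBump_mem_Icc p.2).1,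
    mul_le_one₀ (anisotropicCutoff_mem_Icc he n ω p).2 (zoneBump_mem_Icc p.2).1 (zoneBump_mem_Icc p.2).2⟩

/-- The symbol is `N/D`. [folklore] -/
theorem sectorSymbol_eq (e₀ μ : ℝ) (n : ℕ) (ω : ℤ) (p : ℝ × (Fin 2 → ℝ)) :
    sectorSymbol e₀ μ n ω p = (sectorNumer e₀ μ n ω p : ℂ) / sectorDenom μ p := rfl

/-- The algebra of the symmetric normalisation: `(√N/√|D|)(√N√|D|/D) = N/D` (both sides vanish where
`D = 0`). [folklore] -/
theorem sqrt_div_mul_sqrt_mul_div' {N : ℝ} (hN : 0 ≤ N) (D : ℂ) :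
    ((Real.sqrt N / Real.sqrt ‖D‖ : ℝ) : ℂ) * (((Real.sqrt N * Real.sqrt ‖D‖ : ℝ) : ℂ) / D) = (N : ℂ) / D := by
  rcases eq_or_ne D 0 with rfl | hD
  · simp
  · have hs : Real.sqrt ‖D‖ ≠ 0 := (Real.sqrt_pos.2 (norm_pos_iff.2 hD)).ne'
    rw [← mul_div_assoc]
    congr 1
    have h1 : Real.sqrt N / Real.sqrt ‖D‖ * (Real.sqrt N * Real.sqrt ‖D‖) = Real.sqrt N * Real.sqrt N := by
      field_simp
    have : Real.sqrt N / Real.sqrt ‖D‖ * (Real.sqrt N * Real.sqrt ‖D‖) = N := by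
      rw [h1, Real.mul_self_sqrt hN]
    exact_mod_cast this

/-- **Pointwise Gram identity**: `conj(A_x(k)) B_y(k) = e^{iφ(x-y)(k)} N(k)/D(k)`, the integrand of
`g^{(h)}_ω(x - y)`. [cite: BenfattoGiulianiMastropietro2003, §3 (3.51)] -/
theorem conj_sectorGramAFun_mul_sectorGramBFun {e₀ μ : ℝ} (he : 0 < e₀) (n : ℕ) (ω : ℤ) (x₀ y₀ : ℝ)
    (x y : Fin 2 → ℝ) (p : ℝ × (Fin 2 → ℝ)) :
    conj (sectorGramAFun e₀ μ n ω x₀ x p) * sectorGramBFun e₀ μ n ω y₀ y p =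
      sectorPlaneWave (x₀ - y₀) (x - y) p * sectorSymbol e₀ μ n ω p := by
  rw [sectorGramAFun, sectorGramBFun, map_mul, Complex.conj_conj, Complex.conj_ofReal, sectorSymbol_eq,
    ← sqrt_div_mul_sqrt_mul_div' (sectorNumer_mem_Icc he n ω p).1 (sectorDenom μ p), ← sectorPlaneWave_mul_conj]
  ring

/-- `|A_x(k)|² = N(k)/|D(k)|`. [folklore] -/
theorem norm_sq_sectorGramAFun {e₀ μ : ℝ} (he : 0 < e₀) (n : ℕ) (ω : ℤ) (x₀ : ℝ) (x : Fin 2 → ℝ) (p : ℝ × (Fin 2 → ℝ)) :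
    ‖sectorGramAFun e₀ μ n ω x₀ x p‖ ^ 2 = sectorNumer e₀ μ n ω p / ‖sectorDenom μ p‖ := by
  have hN := (sectorNumer_mem_Icc (μ := μ) he n ω p).1
  rw [sectorGramAFun, norm_mul, Complex.norm_conj, norm_sectorPlaneWave, one_mul, Complex.norm_real, Real.norm_eq_abs,
    sq_abs, div_pow, Real.sq_sqrt hN, Real.sq_sqrt (norm_nonneg _)]

/-- `|B_y(k)|² = N(k)/|D(k)|`. [folklore] -/
theorem norm_sq_sectorGramBFun {e₀ μ : ℝ} (he : 0 < e₀) (n : ℕ) (ω : ℤ) (y₀ : ℝ) (y : Fin 2 → ℝ) (p : ℝ × (Fin 2 → ℝ)) :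
    ‖sectorGramBFun e₀ μ n ω y₀ y p‖ ^ 2 = sectorNumer e₀ μ n ω p / ‖sectorDenom μ p‖ := by
  have hN := (sectorNumer_mem_Icc (μ := μ) he n ω p).1
  rcases eq_or_ne (sectorDenom μ p) 0 with hD | hD
  · simp [sectorGramBFun, hD]
  · have hDn : 0 < ‖sectorDenom μ p‖ := norm_pos_iff.2 hD
    rw [sectorGramBFun, norm_mul, Complex.norm_conj, norm_sectorPlaneWave, one_mul, norm_div, Complex.norm_real,
      Real.norm_eq_abs, div_pow, sq_abs, mul_pow, Real.sq_sqrt hN, Real.sq_sqrt hDn.le]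
    field_simp

/-- **`N/|D| ≤ (e₀ 4^{-n-2})⁻¹`** and it vanishes off the support box (as the symbol). [cite: BenfattoGiulianiMastropietro2006, §2.5 (2.49)–(2.50)] -/
theorem sectorNumer_div_norm_le {e₀ μ : ℝ} (he : 0 < e₀) (n : ℕ) (ω : ℤ) (p : ℝ × (Fin 2 → ℝ)) :
    sectorNumer e₀ μ n ω p / ‖sectorDenom μ p‖ ≤ (e₀ * (4 : ℝ) ^ (-(n : ℤ) - 2))⁻¹ := by
  have h := norm_sectorSymbol_le (μ := μ) he n ω p
  rw [sectorSymbol_eq, norm_div, Complex.norm_real, Real.norm_eq_abs,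
    abs_of_nonneg (sectorNumer_mem_Icc he n ω p).1] at h
  exact h

/-! ### Measurability and square-integrability -/

section L2

variable {μ : ℝ} (hμ₁ : -4 < μ) (hμ₂ : μ < -2 - Real.sqrt 2)
include hμ₁ hμ₂

omit hμ₁ hμ₂ in
/-- The phase is continuous in `k`. [folklore] -/
theorem continuous_sectorPlaneWave (x₀ : ℝ) (x : Fin 2 → ℝ) : Continuous (sectorPlaneWave x₀ x) := by
  unfold sectorPlaneWave
  fun_prop

omit hμ₁ hμ₂ in
/-- The numerator is continuous (`0 < e₀ ≤ (4+μ)/2`). [folklore] -/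
theorem continuous_sectorNumer {e₀ : ℝ} (he : 0 < e₀) (he' : e₀ ≤ (4 + μ) / 2) (n : ℕ) (ω : ℤ) :
    Continuous (sectorNumer e₀ μ n ω) := by
  have h4 : 0 < 4 + μ := by linarith
  have h1 : ContDiff ℝ 0 (anisotropicCutoff e₀ μ n ω) := contDiff_anisotropicCutoff he (by linarith) n ω
  have h2 : ContDiff ℝ 0 zoneBump := contDiff_zoneBump
  exact h1.continuous.mul (h2.continuous.comp continuous_snd)

omit hμ₁ hμ₂ in
/-- The denominator is continuous. [folklore] -/
theorem continuous_sectorDenom' : Continuous (sectorDenom μ) := by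
  have h1 : ContDiff ℝ 0 sqDispersion := contDiff_sqDispersion
  unfold sectorDenom
  exact ((continuous_const.mul (Complex.continuous_ofReal.comp continuous_fst)).neg).add
    (Complex.continuous_ofReal.comp ((h1.continuous.comp continuous_snd).sub continuous_const))

omit hμ₁ hμ₂ in
/-- `A_x` is measurable. [folklore] -/
theorem measurable_sectorGramAFun {e₀ : ℝ} (he : 0 < e₀) (he' : e₀ ≤ (4 + μ) / 2) (n : ℕ) (ω : ℤ) (x₀ : ℝ) (x : Fin 2 → ℝ) :
    Measurable (sectorGramAFun e₀ μ n ω x₀ x) := by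
  unfold sectorGramAFun
  refine (Complex.continuous_conj.comp (continuous_sectorPlaneWave x₀ x)).measurable.mul (Complex.measurable_ofReal.comp ?_)
  exact ((continuous_sectorNumer he he' n ω).measurable.sqrt).div (continuous_sectorDenom'.measurable.norm.sqrt)

omit hμ₁ hμ₂ in
/-- `B_y` is measurable. [folklore] -/
theorem measurable_sectorGramBFun {e₀ : ℝ} (he : 0 < e₀) (he' : e₀ ≤ (4 + μ) / 2) (n : ℕ) (ω : ℤ) (y₀ : ℝ) (y : Fin 2 → ℝ) :
    Measurable (sectorGramBFun e₀ μ n ω y₀ y) := by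
  unfold sectorGramBFun
  refine (Complex.continuous_conj.comp (continuous_sectorPlaneWave y₀ y)).measurable.mul
    ((Complex.measurable_ofReal.comp ?_).div continuous_sectorDenom'.measurable)
  exact ((continuous_sectorNumer he he' n ω).measurable.sqrt).mul (continuous_sectorDenom'.measurable.norm.sqrt)

/-- **`∫ N/|D| ≤ 128 B₁(n) B₂(n)`** (sup times volume of the support, as in `norm_sectorPropagator_le`),
together with the integrability of `N/|D|`. [cite: BenfattoGiulianiMastropietro2006, §2.5 Lemma 2.2] -/
theorem integral_sectorNumer_div_norm_le {e₀ : ℝ} (he : 0 < e₀) (he' : e₀ ≤ (4 + μ) / 2) (n : ℕ) (ω : ℤ) :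
    Integrable (fun p => sectorNumer e₀ μ n ω p / ‖sectorDenom μ p‖) ∧
      ∫ p, sectorNumer e₀ μ n ω p / ‖sectorDenom μ p‖ ≤ 128 * (normalExtent μ e₀ n * tangentExtent μ e₀ n) := by
  set θ₀ : ℝ := ((ω : ℝ) + 1 / 2) * sectorWidth n with hθ₀
  set a : ℝ := e₀ * (4 : ℝ) ^ (-(n : ℤ)) with ha
  set B₁ := normalExtent μ e₀ n with hB₁
  set B₂ := tangentExtent μ e₀ n with hB₂
  have ha0 : 0 < a := mul_pos he (zpow_pos (by norm_num) _)
  have hB₁0 : 0 ≤ B₁ := normalExtent_nonneg hμ₁ hμ₂ he n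
  have hB₂0 : 0 ≤ B₂ := tangentExtent_nonneg hμ₁ he n
  set M : ℝ := (e₀ * (4 : ℝ) ^ (-(n : ℤ) - 2))⁻¹ with hM
  have hM0 : 0 ≤ M := by rw [hM]; exact inv_nonneg.2 (mul_pos he (zpow_pos (by norm_num) _)).le
  set T : Set (ℝ × (Fin 2 → ℝ)) := Icc (-a) a ×ˢ sectorBox μ θ₀ B₁ B₂ with hT
  set f : ℝ × (Fin 2 → ℝ) → ℝ := fun p => sectorNumer e₀ μ n ω p / ‖sectorDenom μ p‖ with hf
  have hf0 : ∀ p, 0 ≤ f p := fun p => div_nonneg (sectorNumer_mem_Icc he n ω p).1 (norm_nonneg _)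
  have hfM : ∀ p, f p ≤ M := fun p => sectorNumer_div_norm_le he n ω p
  have hfT : ∀ p, p ∉ T → f p = 0 := by
    intro p hp
    by_contra hne
    have hN : sectorNumer e₀ μ n ω p ≠ 0 := by
      intro h0; exact hne (by rw [hf]; simp only; rw [h0, zero_div])
    have hS : sectorSymbol e₀ μ n ω p ≠ 0 := by
      rw [sectorSymbol_eq]
      obtain ⟨hsc, -⟩ := mul_ne_zero_iff.1 hN
      have hD := (anisotropicCutoff_ne_zero_scale he hsc).1
      rw [← norm_sectorDenom] at hD
      have hD0 : sectorDenom μ p ≠ 0 := by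
        intro h0; rw [h0, norm_zero] at hD
        exact absurd hD (not_lt.2 (mul_pos he (zpow_pos (by norm_num) _)).le)
      exact div_ne_zero (by exact_mod_cast hN) hD0
    obtain ⟨h1, h2⟩ := sectorSymbol_ne_zero hμ₁ hμ₂ he he' hS
    exact hp (mk_mem_prod h1 h2)
  -- the volume of `T`
  have hvol : volume T ≤ ENNReal.ofReal (2 * a) * (ENNReal.ofReal (2 * B₁) * ENNReal.ofReal (2 * B₂)) := by
    rw [hT, MeasureTheory.Measure.volume_eq_prod, Measure.prod_prod, Real.volume_Icc, show a - -a = 2 * a by ring]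
    gcongr
    exact volume_sectorBox_le hμ₁ hμ₂ θ₀ B₁ B₂
  have hvolT : volume T < ⊤ := lt_of_le_of_lt hvol (by
    refine ENNReal.mul_lt_top ENNReal.ofReal_lt_top (ENNReal.mul_lt_top ENNReal.ofReal_lt_top ENNReal.ofReal_lt_top))
  have hvolR : (volume T).toReal ≤ 2 * a * (2 * B₁ * (2 * B₂)) := by
    have := ENNReal.toReal_mono (by
      refine ENNReal.mul_ne_top ENNReal.ofReal_ne_top (ENNReal.mul_ne_top ENNReal.ofReal_ne_top ENNReal.ofReal_ne_top)) hvol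
    rwa [ENNReal.toReal_mul, ENNReal.toReal_mul, ENNReal.toReal_ofReal (by positivity),
      ENNReal.toReal_ofReal (by positivity), ENNReal.toReal_ofReal (by positivity)] at this
  -- measurability and integrability: `f` is bounded and vanishes off the finite-measure set `T`
  have hfm : AEStronglyMeasurable f volume := by
    refine (Measurable.aestronglyMeasurable ?_)
    exact (continuous_sectorNumer he he' n ω).measurable.div continuous_sectorDenom'.measurable.norm
  have hnc : Continuous (normalCoord μ θ₀) := by unfold normalCoord; fun_prop
  have htc : Continuous (tangentCoord μ θ₀) := by unfold tangentCoord; fun_prop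
  have hBox : IsClosed (sectorBox μ θ₀ B₁ B₂) :=
    (isClosed_le (continuous_abs.comp hnc) continuous_const).inter (isClosed_le (continuous_abs.comp htc) continuous_const)
  have hTm : MeasurableSet T := measurableSet_Icc.prod hBox.measurableSet
  have hfind : f = T.indicator f := by
    funext p
    by_cases hp : p ∈ T
    · rw [indicator_of_mem hp]
    · rw [indicator_of_notMem hp, hfT p hp]
  have hfi : Integrable f := by
    rw [hfind, integrable_indicator_iff hTm]
    refine Measure.integrableOn_of_bounded (M := M) hvolT.ne hfm ?_
    exact ae_of_all _ fun p => by rw [Real.norm_eq_abs, abs_of_nonneg (hf0 p)]; exact hfM p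
  refine ⟨hfi, ?_⟩
  calc ∫ p, f p = ∫ p in T, f p := by rw [setIntegral_eq_integral_of_forall_compl_eq_zero hfT]
    _ ≤ ‖∫ p in T, f p‖ := le_norm_self _
    _ ≤ M * (volume T).toReal := norm_setIntegral_le_of_norm_le_const hvolT fun p _ => by
        rw [Real.norm_eq_abs, abs_of_nonneg (hf0 p)]; exact hfM p
    _ ≤ M * (2 * a * (2 * B₁ * (2 * B₂))) := mul_le_mul_of_nonneg_left hvolR hM0
    _ = 128 * (B₁ * B₂) := by
        rw [hM, ha, zpow_sub₀ (by norm_num : (4 : ℝ) ≠ 0)]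
        field_simp
        ring

/-- `A_x ∈ L²`. [folklore] -/
theorem memLp_sectorGramAFun {e₀ : ℝ} (he : 0 < e₀) (he' : e₀ ≤ (4 + μ) / 2) (n : ℕ) (ω : ℤ) (x₀ : ℝ) (x : Fin 2 → ℝ) :
    MemLp (sectorGramAFun e₀ μ n ω x₀ x) 2 volume := by
  refine (memLp_two_iff_integrable_sq_norm (measurable_sectorGramAFun he he' n ω x₀ x).aestronglyMeasurable).2 ?_
  simp_rw [norm_sq_sectorGramAFun he]
  exact (integral_sectorNumer_div_norm_le hμ₁ hμ₂ he he' n ω).1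

/-- `B_y ∈ L²`. [folklore] -/
theorem memLp_sectorGramBFun {e₀ : ℝ} (he : 0 < e₀) (he' : e₀ ≤ (4 + μ) / 2) (n : ℕ) (ω : ℤ) (y₀ : ℝ) (y : Fin 2 → ℝ) :
    MemLp (sectorGramBFun e₀ μ n ω y₀ y) 2 volume := by
  refine (memLp_two_iff_integrable_sq_norm (measurable_sectorGramBFun he he' n ω y₀ y).aestronglyMeasurable).2 ?_
  simp_rw [norm_sq_sectorGramBFun he]
  exact (integral_sectorNumer_div_norm_le hμ₁ hμ₂ he he' n ω).1

/-! ### The Gram vectors in `L²` and the Gram identity -/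

/-- **The Gram vector `A_x ∈ L²(ℝ × ℝ²)`.** [cite: BenfattoGiulianiMastropietro2003, §3 (3.52)] -/
def sectorGramA {e₀ : ℝ} (he : 0 < e₀) (he' : e₀ ≤ (4 + μ) / 2) (n : ℕ) (ω : ℤ) (x₀ : ℝ) (x : Fin 2 → ℝ) :
    Lp ℂ 2 (volume : Measure (ℝ × (Fin 2 → ℝ))) :=
  (memLp_sectorGramAFun hμ₁ hμ₂ he he' n ω x₀ x).toLp _

/-- **The Gram vector `B_y ∈ L²(ℝ × ℝ²)`.** [cite: BenfattoGiulianiMastropietro2003, §3 (3.52)] -/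
def sectorGramB {e₀ : ℝ} (he : 0 < e₀) (he' : e₀ ≤ (4 + μ) / 2) (n : ℕ) (ω : ℤ) (y₀ : ℝ) (y : Fin 2 → ℝ) :
    Lp ℂ 2 (volume : Measure (ℝ × (Fin 2 → ℝ))) :=
  (memLp_sectorGramBFun hμ₁ hμ₂ he he' n ω y₀ y).toLp _

/-- **The sector propagator is a Gram matrix**: `⟪A_x, B_y⟫ = g^{(h)}_ω(x - y)`. [cite: BenfattoGiulianiMastropietro2003, §3 (3.50a)–(3.51)] -/
theorem inner_sectorGramA_sectorGramB {e₀ : ℝ} (he : 0 < e₀) (he' : e₀ ≤ (4 + μ) / 2) (n : ℕ) (ω : ℤ)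
    (x₀ y₀ : ℝ) (x y : Fin 2 → ℝ) :
    ⟪sectorGramA hμ₁ hμ₂ he he' n ω x₀ x, sectorGramB hμ₁ hμ₂ he he' n ω y₀ y⟫_ℂ =
      sectorPropagator e₀ μ n ω (x₀ - y₀) (x - y) := by
  rw [MeasureTheory.L2.inner_def, sectorPropagator]
  refine integral_congr_ae ?_
  filter_upwards [MemLp.coeFn_toLp (memLp_sectorGramAFun hμ₁ hμ₂ he he' n ω x₀ x),
    MemLp.coeFn_toLp (memLp_sectorGramBFun hμ₁ hμ₂ he he' n ω y₀ y)] with p hA hB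
  rw [sectorGramA, sectorGramB] at *
  rw [hA, hB, RCLike.inner_apply, mul_comm, conj_sectorGramAFun_mul_sectorGramBFun he]
  rfl

omit hμ₁ hμ₂ in
/-- `‖f‖²_{L²} = ∫ ‖f‖²` for an `L²` class given by a function. [folklore] -/
theorem norm_toLp_sq_eq_integral {f : ℝ × (Fin 2 → ℝ) → ℂ} (hf : MemLp f 2 volume) :
    ‖hf.toLp f‖ ^ 2 = ∫ p, ‖f p‖ ^ 2 := by
  rw [@norm_sq_eq_re_inner ℂ, MeasureTheory.L2.inner_def]
  have h : ∫ p, ⟪(hf.toLp f) p, (hf.toLp f) p⟫_ℂ = ∫ p, (((‖f p‖ ^ 2 : ℝ)) : ℂ) := by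
    refine integral_congr_ae ?_
    filter_upwards [MemLp.coeFn_toLp hf] with p hp
    rw [hp, inner_self_eq_norm_sq_to_K]
    push_cast; rfl
  rw [h, integral_complex_ofReal, RCLike.re_to_complex, Complex.ofReal_re]

/-- **`‖A_x‖² ≤ 128 B₁(n) B₂(n)`** — the same dimensional bound as the propagator (`O(γ^{(3/2)h})`). [cite: BenfattoGiulianiMastropietro2003, §3 after (3.51)] -/
theorem norm_sq_sectorGramA_le {e₀ : ℝ} (he : 0 < e₀) (he' : e₀ ≤ (4 + μ) / 2) (n : ℕ) (ω : ℤ) (x₀ : ℝ) (x : Fin 2 → ℝ) :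
    ‖sectorGramA hμ₁ hμ₂ he he' n ω x₀ x‖ ^ 2 ≤ 128 * (normalExtent μ e₀ n * tangentExtent μ e₀ n) := by
  rw [sectorGramA, norm_toLp_sq_eq_integral]
  simp_rw [norm_sq_sectorGramAFun he]
  exact (integral_sectorNumer_div_norm_le hμ₁ hμ₂ he he' n ω).2

/-- **`‖B_y‖² ≤ 128 B₁(n) B₂(n)`.** [cite: BenfattoGiulianiMastropietro2003, §3 after (3.51)] -/
theorem norm_sq_sectorGramB_le {e₀ : ℝ} (he : 0 < e₀) (he' : e₀ ≤ (4 + μ) / 2) (n : ℕ) (ω : ℤ) (y₀ : ℝ) (y : Fin 2 → ℝ) :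
    ‖sectorGramB hμ₁ hμ₂ he he' n ω y₀ y‖ ^ 2 ≤ 128 * (normalExtent μ e₀ n * tangentExtent μ e₀ n) := by
  rw [sectorGramB, norm_toLp_sq_eq_integral]
  simp_rw [norm_sq_sectorGramBFun he]
  exact (integral_sectorNumer_div_norm_le hμ₁ hμ₂ he he' n ω).2

/-- Hence **`|g^{(h)}_ω(x - y)| ≤ ‖A_x‖ ‖B_y‖ ≤ 128 B₁(n) B₂(n)`** (Cauchy–Schwarz; consistency with
`norm_sectorPropagator_le`). [cite: BenfattoGiulianiMastropietro2003, §3 (3.50)] -/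
theorem norm_sectorPropagator_le_norm_mul_norm {e₀ : ℝ} (he : 0 < e₀) (he' : e₀ ≤ (4 + μ) / 2) (n : ℕ) (ω : ℤ)
    (x₀ y₀ : ℝ) (x y : Fin 2 → ℝ) :
    ‖sectorPropagator e₀ μ n ω (x₀ - y₀) (x - y)‖ ≤
      ‖sectorGramA hμ₁ hμ₂ he he' n ω x₀ x‖ * ‖sectorGramB hμ₁ hμ₂ he he' n ω y₀ y‖ := by
  rw [← inner_sectorGramA_sectorGramB hμ₁ hμ₂ he he']
  exact norm_inner_le_norm _ _

end L2

end Literature.MathematicalPhysics.QuantumLattice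

end
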